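import Mathlib
import Summits.Ventures.PercRepro2.PairHarris

/-!
# Typed Harris for mixed monotone events, and the Harris layer of the typed BHK 1.1 with avoid sets
(blind cell PercRepro2, p5 g7, 2026-08-26; `proofs/P5-COUPLING.md` §1–§2, sub-claim S4 §2.4 (i))

`pairCount F z Φ` (`A3InactiveTyped`) sums `Φ y (flipOn F y)` over the admissible first copies `y`:
the second copy is the complement of the first on the free edges.  Typed Harris
(`PairHarris.pairCount_harris`) says that for up-sets `A, B` the cross-copy count `N(A; B)` is at most
the same-copy count `N(A ∩ B; Ω)`.

* `pairCount_harris_mixed`: the same with one DOWN-set on each side —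
  `N(A ∩ C; B ∩ D) ≤ N(A ∩ B; C ∩ D)` for up-sets `A, B` and down-sets `C, D`: the up-sets gather
  in the first copy, the down-sets in the second.  Proof: pulling a down-set back along the
  admissible complement map `flipAdm F z` (complement on `F`, the pinning `z` off `F`; antitone)
  gives an up-set, `A ∩ flipAdmSet F z D` and `B ∩ flipAdmSet F z C` are up-sets, and
  `pairCount_harris` for them is literally the claim on the admissible pairs `(y, flipOn F y)`.
* `pairCount_avoid_le`: the cluster-event instance — for a root `s`, vertices `u, v` and avoid sets
  `X, Y ⊆ V`: `#{y : u ∈ C_y(s), C_y(s) ∩ X = ∅, v ∈ C_ȳ(s), C_ȳ(s) ∩ Y = ∅} ≤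
  #{y : u, v ∈ C_y(s), C_ȳ(s) ∩ (X ∪ Y) = ∅}` at every profile.  This is the typed form of the
  base case `X ∩ Y = ∅` of van den Berg–Häggström–Kahn's Theorem 1.1 (their two Harris
  applications become one typed Harris): the candidate (T11) of `P5-COUPLING.md` §1,
  `N(A ∧ R_X ; B ∧ R_Y) ≤ N(A ∧ B ∧ R_{X∩Y} ; R_{X∪Y})`, coincides with this theorem exactly when
  `X ∩ Y = ∅`, and is stronger by the red-copy factor `R_{X∩Y}` otherwise — that factor (the
  symmetric two-colour conditioning on `X ∩ Y`) is the whole open content of (T11) / (TB13).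
* `pairCount_avoid_le_singleton`: the one-vertex avoid sets, in the `iQ` vocabulary.

Record note (S4 v37 score, minor m₁₄): the named Prop `TB14Territory.TerritoryDom` of
`TB14Territory.lean` is census-FALSE (NEG-157: the territory-fibre statements (F) / (DOM) fail at
`n = 7` while row 2′TB holds), so its bridge theorems are no route; its lifting lemma
`conn_a1_of_bGraph_subset` is a true theorem.  Own work; standard axioms.
-/

namespace Summit.Ventures.PercRepro2

namespace TypedHarrisMixed

open CovForm A3InactiveTyped PairHarris

section Flip

variable {E : Type*} [DecidableEq E]

/-- The admissible complement: the complement of `y` on the free edges `F`, the pinning `z` off `F`.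
On the admissible first copies it is `flipOn F`; it is antitone on all configurations. -/
def flipAdm (F : Finset E) (z y : Config E) : Config E := fun e => if e ∈ F then !(y e) else z e

/-- On an admissible first copy the admissible complement is `flipOn F`. -/
lemma flipAdm_eq_flipOn {F : Finset E} {z y : Config E} (hy : ∀ e, e ∉ F → y e = z e) :
    flipAdm F z y = flipOn F y := by
  funext e
  simp only [flipAdm, flipOn]
  by_cases he : e ∈ F
  · simp [he]
  · simp [he, hy e he]

/-- The complement of an admissible first copy is admissible. -/
lemma flipOn_admissible {F : Finset E} {z y : Config E} (hy : ∀ e, e ∉ F → y e = z e) :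
    ∀ e, e ∉ F → flipOn F y e = z e := by
  intro e he
  simp only [flipOn, he, if_false]
  exact hy e he

/-- The admissible complement reverses the order of configurations. -/
lemma flipAdm_antitone (F : Finset E) (z : Config E) : Antitone (flipAdm F z) := by
  intro y y' h e
  simp only [flipAdm]
  by_cases he : e ∈ F
  · simp only [he, if_true]
    have := h e
    cases hy : y e <;> cases hy' : y' e <;> simp_all
  · simp only [he, if_false, le_refl]

/-- The pull-back of a set of configurations along the admissible complement. -/
def flipAdmSet (F : Finset E) (z : Config E) (C : Set (Config E)) : Set (Config E) :=
  {y | flipAdm F z y ∈ C}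

/-- Membership in `flipAdmSet`. -/
lemma mem_flipAdmSet {F : Finset E} {z : Config E} {C : Set (Config E)} {y : Config E} :
    y ∈ flipAdmSet F z C ↔ flipAdm F z y ∈ C := Iff.rfl

/-- The pull-back of a down-set along the admissible complement is an up-set. -/
lemma isUpperSet_flipAdmSet {F : Finset E} {z : Config E} {C : Set (Config E)}
    (hC : IsLowerSet C) : IsUpperSet (flipAdmSet F z C) :=
  fun _ _ h hy => hC (flipAdm_antitone F z h) hy

end Flip

section Mixed

variable {E : Type*} [Fintype E] [DecidableEq E] {R : Type*} [Field R] [LinearOrder R]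
  [IsStrictOrderedRing R]

omit [LinearOrder R] [IsStrictOrderedRing R] in
/-- Two-copy counts of integrands that agree on the admissible pairs `(y, flipOn F y)` coincide. -/
lemma pairCount_congr (F : Finset E) (z : Config E) {Φ Ψ : Config E → Config E → R}
    (h : ∀ y, (∀ e, e ∉ F → y e = z e) → Φ y (flipOn F y) = Ψ y (flipOn F y)) :
    pairCount F z Φ = pairCount F z Ψ := by
  unfold pairCount
  refine Finset.sum_congr rfl fun y _ => ?_
  split_ifs with hy
  · exact h y hy
  · rfl

omit [Fintype E] [LinearOrder R] [IsStrictOrderedRing R] in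
/-- The pulled-back indicator at an admissible first copy. -/
lemma indicator_flipAdmSet_of_admissible {F : Finset E} {z y : Config E} {C : Set (Config E)}
    (hy : ∀ e, e ∉ F → y e = z e) :
    (flipAdmSet F z C).indicator (1 : Config E → R) y = C.indicator 1 (flipOn F y) := by
  have hmem : y ∈ flipAdmSet F z C ↔ flipOn F y ∈ C := by
    rw [mem_flipAdmSet, flipAdm_eq_flipOn hy]
  by_cases h : flipOn F y ∈ C
  · rw [Set.indicator_of_mem h, Set.indicator_of_mem (hmem.2 h)]
    rfl
  · rw [Set.indicator_of_notMem h, Set.indicator_of_notMem (fun h' => h (hmem.1 h'))]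

/-- **Typed Harris with one down-set on each side**: for up-sets `A, B` and down-sets `C, D` of
configurations, at every profile `N(A ∩ C; B ∩ D) ≤ N(A ∩ B; C ∩ D)` — the up-sets collected in
the first copy, the down-sets in the second. -/
theorem pairCount_harris_mixed (F : Finset E) (z : Config E) (A B C D : Set (Config E))
    (hA : IsUpperSet A) (hB : IsUpperSet B) (hC : IsLowerSet C) (hD : IsLowerSet D) :
    pairCount F z (fun y w => A.indicator (1 : Config E → R) y * C.indicator 1 y *
        (B.indicator 1 w * D.indicator 1 w)) ≤
      pairCount F z (fun y w => A.indicator (1 : Config E → R) y * B.indicator 1 y *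
        (C.indicator 1 w * D.indicator 1 w)) := by
  have hA' : IsUpperSet (A ∩ flipAdmSet F z D) := hA.inter (isUpperSet_flipAdmSet hD)
  have hB' : IsUpperSet (B ∩ flipAdmSet F z C) := hB.inter (isUpperSet_flipAdmSet hC)
  have key := pairCount_harris (R := R) F z (A ∩ flipAdmSet F z D) (B ∩ flipAdmSet F z C) hA' hB'
  have hl : pairCount F z (fun y w => (A ∩ flipAdmSet F z D).indicator (1 : Config E → R) y *
      (B ∩ flipAdmSet F z C).indicator 1 w) =
      pairCount F z (fun y w => A.indicator (1 : Config E → R) y * C.indicator 1 y *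
        (B.indicator 1 w * D.indicator 1 w)) := by
    refine pairCount_congr F z fun y hy => ?_
    simp only [Set.inter_indicator_one, Pi.mul_apply]
    rw [indicator_flipAdmSet_of_admissible hy,
      indicator_flipAdmSet_of_admissible (flipOn_admissible hy)]
    have h3 : flipOn F (flipOn F y) = y := A3InactiveTyped.flipOn_flipOn F y
    rw [h3]
    ring
  have hr : pairCount F z (fun y _ => (A ∩ flipAdmSet F z D).indicator (1 : Config E → R) y *
      (B ∩ flipAdmSet F z C).indicator 1 y) =
      pairCount F z (fun y w => A.indicator (1 : Config E → R) y * B.indicator 1 y *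
        (C.indicator 1 w * D.indicator 1 w)) := by
    refine pairCount_congr F z fun y hy => ?_
    simp only [Set.inter_indicator_one, Pi.mul_apply]
    rw [indicator_flipAdmSet_of_admissible hy, indicator_flipAdmSet_of_admissible hy]
    ring
  rw [← hl, ← hr]
  exact key

end Mixed

section Avoid

variable {V : Type*} [DecidableEq V] {E : Type*} [Fintype E] [DecidableEq E] {R : Type*} [Field R]
  [LinearOrder R] [IsStrictOrderedRing R]

omit [DecidableEq V] [Fintype E] [DecidableEq E] in
/-- `{s ↮ x for all x ∈ X}` is a decreasing event. -/
lemma isLowerSet_avoidAll (ends : E → Sym2 V) (s : V) (X : Finset V) :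
    IsLowerSet (avoidAll ends s X) :=
  fun _ _ h hω x hx hc => hω x hx (conn_mono h hc)

omit [Fintype E] [DecidableEq E] [Field R] [LinearOrder R] [IsStrictOrderedRing R] in
/-- Avoiding a union is avoiding both parts. -/
lemma avoidAll_union (ends : E → Sym2 V) (s : V) (X Y : Finset V) :
    avoidAll ends s (X ∪ Y) = avoidAll ends s X ∩ avoidAll ends s Y := by
  ext ω
  simp only [avoidAll, Set.mem_setOf_eq, Set.mem_inter_iff, Finset.mem_union]
  constructor
  · intro h
    exact ⟨fun x hx => h x (Or.inl hx), fun x hx => h x (Or.inr hx)⟩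
  · rintro ⟨h₁, h₂⟩ x hx
    rcases hx with hx | hx
    · exact h₁ x hx
    · exact h₂ x hx

omit [Fintype E] [DecidableEq E] [LinearOrder R] [IsStrictOrderedRing R] in
/-- The avoid indicator of a union is the product of the avoid indicators. -/
lemma avoidAll_union_indicator (ends : E → Sym2 V) (s : V) (X Y : Finset V) (ω : Config E) :
    (avoidAll ends s (X ∪ Y)).indicator (1 : Config E → R) ω =
      (avoidAll ends s X).indicator 1 ω * (avoidAll ends s Y).indicator 1 ω := by
  rw [avoidAll_union, Set.inter_indicator_one, Pi.mul_apply]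

/-- **The Harris layer of the typed BHK 1.1 with avoid sets**: for a root `s`, vertices `u, v` and
avoid sets `X, Y`, at every profile
`#{y : u ∈ C_y(s), C_y(s) ∩ X = ∅, v ∈ C_ȳ(s), C_ȳ(s) ∩ Y = ∅} ≤ #{y : u, v ∈ C_y(s), C_ȳ(s) ∩ (X ∪ Y) = ∅}`
(the candidate (T11) with the red-copy factor `R_{X ∩ Y}` dropped; equal to (T11) when `X ∩ Y = ∅`). -/
theorem pairCount_avoid_le (ends : E → Sym2 V) (s u v : V) (X Y : Finset V) (F : Finset E)
    (z : Config E) :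
    pairCount F z (fun y w => iL ends s u y * (avoidAll ends s X).indicator 1 y *
        (iL ends s v w * (avoidAll ends s Y).indicator 1 w) : Config E → Config E → R) ≤
      pairCount F z (fun y w => iL ends s u y * iL ends s v y *
        (avoidAll ends s (X ∪ Y)).indicator 1 w) := by
  have key := pairCount_harris_mixed (R := R) F z (connEvent ends s u) (connEvent ends s v)
    (avoidAll ends s X) (avoidAll ends s Y) (isUpperSet_connEvent ends s u)
    (isUpperSet_connEvent ends s v) (isLowerSet_avoidAll ends s X) (isLowerSet_avoidAll ends s Y)
  have hr : pairCount F z (fun y w => iL ends s u y * iL ends s v y *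
      (avoidAll ends s (X ∪ Y)).indicator 1 w : Config E → Config E → R) =
      pairCount F z (fun y w => (connEvent ends s u).indicator (1 : Config E → R) y *
        (connEvent ends s v).indicator 1 y *
        ((avoidAll ends s X).indicator 1 w * (avoidAll ends s Y).indicator 1 w)) := by
    refine pairCount_congr F z fun y _ => ?_
    rw [avoidAll_union_indicator]
    rfl
  rw [hr]
  exact key

omit [DecidableEq V] in
/-- The one-vertex case in the `iQ` vocabulary (`iQ ends x s = 1_{s ↮ x}`). -/
theorem pairCount_avoid_le_singleton (ends : E → Sym2 V) (s u v x x' : V) (F : Finset E)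
    (z : Config E) :
    pairCount F z (fun y w => iL ends s u y * iQ ends x s y * (iL ends s v w * iQ ends x' s w) :
        Config E → Config E → R) ≤
      pairCount F z (fun y w => iL ends s u y * iL ends s v y * (iQ ends x s w * iQ ends x' s w)) :=
  pairCount_harris_mixed (R := R) F z (connEvent ends s u) (connEvent ends s v)
    (avoidAll ends s {x}) (avoidAll ends s {x'}) (isUpperSet_connEvent ends s u)
    (isUpperSet_connEvent ends s v) (isLowerSet_avoidAll ends s {x})
    (isLowerSet_avoidAll ends s {x'})

end Avoid

end TypedHarrisMixed

end Summit.Ventures.PercRepro2
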